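import Literature.NumberTheory.Sieve.RosserSieveMajorantPackage
import HarnessLib

/-!
# Rosser's sieve: the majorant package at `β = 1` (dimension `κ = 1/2`)

Topic `Literature/NumberTheory/Sieve`; Iwaniec, *Rosser's sieve*, Acta Arith. 36 (1980), §7 (7.5) and
§8. For `κ ≤ 1/2` Iwaniec's majorants `q^±` of §6 do not exist (`β = 1`), and in the proof of
Lemma 20 he uses "a `q^±(s)` corresponding to some `κ₁` slightly greater than `1/2`" (p. 194, (7.5)).
This file PROVES a `β = 1` analogue of `RosserSieveMajorantPackage.exists_majorant_package` for the
half-dimensional sieve with loss exponent `e = 3/8`, built from the linear-sieve majorants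
`Z⁺ = qUpper 1 2`, `Z⁻ = qLower 1 2` (`κ₁ = 1`, `β₁ = 2`, as in `RosserSieveHalfLemma17`):

* the Lemma-20 kernel at `κ = 1/2`, `e = 3/8` is `k_e(t) = k(t)(1 − 1/t)^{−3/8} = (1/2) t^{−1/8} (t − 1)^{−7/8}`,
  at most `(1/2)(t − 1)^{−7/8}` and at most one half of the kernel `t/(t − 1)²` of (6.2) for `κ₁ = 1`;
* `H⁺ = 2h Z⁺ + e^{−s}`; `H⁻ = h Z⁻ + e^{−s}` on `[2, ∞)` and, on `(−∞, 2]`,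
  `H⁻ = max(h + e^{−σ}, h ψ(σ) + 5)` with `σ = max(s, 1)`, `ψ(σ) = 4(3^{1/8} − (σ − 1)^{1/8}) + 3/25`
  (an explicit bound for `∫_σ^∞ k_e H⁺(t − 1) dt / h`; `3/25 ≥ Z⁻(4) = 2/3 − (log 3)/2`);
* `exists_majorant_package_one`: for every `ε₁ > 0` (and `h` large) these satisfy `H^± > 0`,
  non-increasing, continuous, `∫_s^U k_e H⁺(· − 1) ≤ (1 + ε₁) H⁻(s)` (`1 < s`),
  `∫_s^U k_e H⁻(· − 1) ≤ (1 + ε₁) H⁺(s)` (`2 ≤ s`), the one-step ratio bounds, Lemma 17 at `κ = 1/2`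
  in the form `T⁻_N ≤ c₀ H⁻` (`s ≥ 1`), `T⁺_N ≤ c₀ H⁺` (`s ≥ 0`) (`RosserSieveHalfLemma17`), and
  `e^{−s} ≤ H^±(s)`.

The second integral inequality on `[2, 3)` is a numerical fact (the mass of `k_e` on `[2, 3]` against the
profile `max(1, ψ)`, about `0.6 h`, plus `h/4` from `[3, ∞)`); it is verified with a five-piece step
function.

Everything here is PROVED; no new definitions (the functions are introduced inside the proof).

## References

* H. Iwaniec, *Rosser's sieve*, Acta Arith. 36 (1980), 171–202: §6 (6.1)–(6.2); §7 (7.4)–(7.6) and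
  p. 194; §8, proof of Lemma 20. [IwaniecActaArith1980]
-/

open Filter Set MeasureTheory intervalIntegral
open scoped Topology

noncomputable section

namespace Literature.NumberTheory.Sieve

namespace BetaSieve

open BetaSieveForward (sieveKernel sieveKernel_nonneg continuousOn_sieveKernel)
open RosserMajorant

/-! ### Numerical constants -/

/-- `c ≤ x^{p/q}` from `c^q ≤ x^p` (`x > 0`, `c ≥ 0`, `q ≠ 0`). [folklore] -/
theorem le_rpow_div_of_pow_le {x c : ℝ} {p q : ℕ} (hx : 0 < x) (hc : 0 ≤ c) (hq : q ≠ 0)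
    (h : c ^ q ≤ x ^ p) : c ≤ x ^ ((p : ℝ) / q) := by
  have h1 : c = (c ^ q) ^ ((q : ℝ)⁻¹) := (Real.pow_rpow_inv_natCast hc hq).symm
  rw [h1, div_eq_mul_inv, Real.rpow_mul hx.le, Real.rpow_natCast]
  exact Real.rpow_le_rpow (pow_nonneg hc q) h (inv_nonneg.mpr (Nat.cast_nonneg q))

/-- `x^{p/q} ≤ c` from `x^p ≤ c^q` (`x ≥ 0`, `c ≥ 0`, `q ≠ 0`). [folklore] -/
theorem rpow_div_le_of_pow_le {x c : ℝ} {p q : ℕ} (hx : 0 ≤ x) (hc : 0 ≤ c) (hq : q ≠ 0)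
    (h : x ^ p ≤ c ^ q) : x ^ ((p : ℝ) / q) ≤ c := by
  have h1 : c = (c ^ q) ^ ((q : ℝ)⁻¹) := (Real.pow_rpow_inv_natCast hc hq).symm
  rw [h1, div_eq_mul_inv, Real.rpow_mul hx, Real.rpow_natCast]
  exact Real.rpow_le_rpow (pow_nonneg hx p) h (inv_nonneg.mpr (Nat.cast_nonneg q))

/-- `3^{1/8} ≤ 1.148` (`1.148⁸ ≥ 3`). [folklore] -/
theorem three_rpow_eighth_le : (3:ℝ) ^ ((1:ℝ) / 8) ≤ 1.148 := by
  have h := rpow_div_le_of_pow_le (x := 3) (c := 1.148) (p := 1) (q := 8) (by norm_num) (by norm_num)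
    (by norm_num) (by norm_num)
  norm_num at h ⊢; exact h

/-- `0.56 ≤ 0.01^{1/8}`. [folklore] -/
theorem rpow_eighth_ge_one : (0.56:ℝ) ≤ (0.01:ℝ) ^ ((1:ℝ) / 8) := by
  have h := le_rpow_div_of_pow_le (x := 0.01) (c := 0.56) (p := 1) (q := 8) (by norm_num) (by norm_num)
    (by norm_num) (by norm_num)
  norm_num at h ⊢; exact h

/-- `0.74 ≤ 0.1^{1/8}`. [folklore] -/
theorem rpow_eighth_ge_two : (0.74:ℝ) ≤ (0.1:ℝ) ^ ((1:ℝ) / 8) := by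
  have h := le_rpow_div_of_pow_le (x := 0.1) (c := 0.74) (p := 1) (q := 8) (by norm_num) (by norm_num)
    (by norm_num) (by norm_num)
  norm_num at h ⊢; exact h

/-- `0.859 ≤ 0.3^{1/8}`. [folklore] -/
theorem rpow_eighth_ge_three : (0.859:ℝ) ≤ (0.3:ℝ) ^ ((1:ℝ) / 8) := by
  have h := le_rpow_div_of_pow_le (x := 0.3) (c := 0.859) (p := 1) (q := 8) (by norm_num) (by norm_num)
    (by norm_num) (by norm_num)
  norm_num at h ⊢; exact h

/-- `0.93 ≤ 0.56^{1/8}`. [folklore] -/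
theorem rpow_eighth_ge_four : (0.93:ℝ) ≤ (0.56:ℝ) ^ ((1:ℝ) / 8) := by
  have h := le_rpow_div_of_pow_le (x := 0.56) (c := 0.93) (p := 1) (q := 8) (by norm_num) (by norm_num)
    (by norm_num) (by norm_num)
  norm_num at h ⊢; exact h

/-- `1.257 ≤ 1.3^{7/8}`. [folklore] -/
theorem rpow_seven_eighths_ge_one : (1.257:ℝ) ≤ (1.3:ℝ) ^ ((7:ℝ) / 8) := by
  have h := le_rpow_div_of_pow_le (x := 1.3) (c := 1.257) (p := 7) (q := 8) (by norm_num) (by norm_num)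
    (by norm_num) (by norm_num)
  norm_num at h ⊢; exact h

/-- `1.475 ≤ 1.56^{7/8}`. [folklore] -/
theorem rpow_seven_eighths_ge_two : (1.475:ℝ) ≤ (1.56:ℝ) ^ ((7:ℝ) / 8) := by
  have h := le_rpow_div_of_pow_le (x := 1.56) (c := 1.475) (p := 7) (q := 8) (by norm_num) (by norm_num)
    (by norm_num) (by norm_num)
  norm_num at h ⊢; exact h

/-- `1.36 ≤ 2^{7/8}`. [folklore] -/
theorem two_rpow_seven_eighths_ge : (1.36:ℝ) ≤ (2:ℝ) ^ ((7:ℝ) / 8) := by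
  have h := le_rpow_div_of_pow_le (x := 2) (c := 1.36) (p := 7) (q := 8) (by norm_num) (by norm_num)
    (by norm_num) (by norm_num)
  norm_num at h ⊢; exact h

/-- `e ≤ 2.72`. [folklore] -/
theorem exp_one_le : Real.exp 1 ≤ 2.72 := Real.exp_one_lt_d9.le.trans (by norm_num)

/-- `e^{−1} ≤ 0.37`. [folklore] -/
theorem exp_neg_one_le : Real.exp (-1) ≤ 0.37 := by
  rw [Real.exp_neg, inv_le_comm₀ (Real.exp_pos _) (by norm_num)]
  exact le_trans (by norm_num) Real.exp_one_gt_d9.le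

/-- `e^{−2} ≤ 0.14`. [folklore] -/
theorem exp_neg_two_le : Real.exp (-2) ≤ 0.14 := by
  have h : Real.exp (-2) = Real.exp (-1) * Real.exp (-1) := by rw [← Real.exp_add]; norm_num
  rw [h]
  have h1 := exp_neg_one_le
  have h0 : 0 ≤ Real.exp (-1) := (Real.exp_pos _).le
  nlinarith

/-- `e^{−3} ≤ 0.06`. [folklore] -/
theorem exp_neg_three_le : Real.exp (-3) ≤ 0.06 := by
  have h : Real.exp (-3) = Real.exp (-2) * Real.exp (-1) := by rw [← Real.exp_add]; norm_num
  rw [h]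
  have h1 := exp_neg_one_le
  have h2 := exp_neg_two_le
  have h0 : 0 ≤ Real.exp (-1) := (Real.exp_pos _).le
  nlinarith

/-- `log 3 ≥ 1.098` (`log 3 = log 2 + log(3/2)`). [folklore] -/
theorem log_three_ge : (1.098:ℝ) ≤ Real.log 3 := by
  have h : Real.log 3 = Real.log 2 + Real.log (3 / 2) := by
    rw [← Real.log_mul (by norm_num) (by norm_num)]; norm_num
  rw [h]
  linarith [Real.log_two_gt_d9, log_three_halves_ge]

/-! ### The Lemma-20 kernel at `κ = 1/2`, `e = 3/8` -/

/-- **`k_e(t) = (1/2) t^{−1/8} (t − 1)^{−7/8}`** for `t > 1` (`k = sieveKernel (1/2)`, `e = 3/8`).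
[cite: IwaniecActaArith1980, §8 (8.10)] -/
theorem kernelE_eq {t : ℝ} (ht : 1 < t) :
    sieveKernel (1 / 2) t * (1 - 1 / t) ^ (-(3 / 8 : ℝ)) =
      (1 / 2) * t ^ (-(1 / 8 : ℝ)) * (t - 1) ^ (-(7 / 8 : ℝ)) := by
  have ht0 : 0 < t := by linarith
  have ht1 : 0 < t - 1 := by linarith
  have e0 : (1 - 1 / t) ^ (-(3 / 8 : ℝ)) = (t - 1) ^ (-(3 / 8 : ℝ)) * t ^ ((3:ℝ) / 8) := by
    rw [show 1 - 1 / t = (t - 1) / t by field_simp, Real.div_rpow ht1.le ht0.le,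
      Real.rpow_neg ht0.le (3 / 8), div_inv_eq_mul]
  rw [sieveKernel, e0]
  have e1 : t ^ ((1:ℝ) / 2 - 1) * t ^ ((3:ℝ) / 8) = t ^ (-(1 / 8 : ℝ)) := by
    rw [← Real.rpow_add ht0]; norm_num
  have e2 : (t - 1) ^ (-(1 / 2 : ℝ)) * (t - 1) ^ (-(3 / 8 : ℝ)) = (t - 1) ^ (-(7 / 8 : ℝ)) := by
    rw [← Real.rpow_add ht1]; norm_num
  calc 1 / 2 * t ^ ((1:ℝ) / 2 - 1) * (t - 1) ^ (-(1 / 2 : ℝ)) * ((t - 1) ^ (-(3 / 8 : ℝ)) * t ^ ((3:ℝ) / 8))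
      = 1 / 2 * (t ^ ((1:ℝ) / 2 - 1) * t ^ ((3:ℝ) / 8)) * ((t - 1) ^ (-(1 / 2 : ℝ)) * (t - 1) ^ (-(3 / 8 : ℝ))) := by
        ring
    _ = 1 / 2 * t ^ (-(1 / 8 : ℝ)) * (t - 1) ^ (-(7 / 8 : ℝ)) := by rw [e1, e2]

/-- `0 ≤ k_e(t)` for `t > 1`. [folklore] -/
theorem kernelE_nonneg {t : ℝ} (ht : 1 < t) : 0 ≤ sieveKernel (1 / 2) t * (1 - 1 / t) ^ (-(3 / 8 : ℝ)) := by
  rw [kernelE_eq ht]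
  have h1 : 0 ≤ t ^ (-(1 / 8 : ℝ)) := Real.rpow_nonneg (by linarith) _
  have h2 : 0 ≤ (t - 1) ^ (-(7 / 8 : ℝ)) := Real.rpow_nonneg (by linarith) _
  positivity

/-- **`k_e(t) ≤ (1/2)(t − 1)^{−7/8}`** for `t > 1` (`t^{−1/8} ≤ 1`). [folklore] -/
theorem kernelE_le_half_rpow {t : ℝ} (ht : 1 < t) :
    sieveKernel (1 / 2) t * (1 - 1 / t) ^ (-(3 / 8 : ℝ)) ≤ (1 / 2) * (t - 1) ^ (-(7 / 8 : ℝ)) := by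
  rw [kernelE_eq ht]
  have h1 : t ^ (-(1 / 8 : ℝ)) ≤ 1 := Real.rpow_le_one_of_one_le_of_nonpos ht.le (by norm_num)
  have h2 : 0 ≤ (t - 1) ^ (-(7 / 8 : ℝ)) := Real.rpow_nonneg (by linarith) _
  nlinarith

/-- `k_e(t) ≤ (1/2)(a − 1)^{−7/8}` for `t ≥ a > 1`. [folklore] -/
theorem kernelE_le_of_le {a t : ℝ} (ha : 1 < a) (hat : a ≤ t) :
    sieveKernel (1 / 2) t * (1 - 1 / t) ^ (-(3 / 8 : ℝ)) ≤ (1 / 2) * (a - 1) ^ (-(7 / 8 : ℝ)) := by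
  refine (kernelE_le_half_rpow (by linarith)).trans ?_
  have : (t - 1) ^ (-(7 / 8 : ℝ)) ≤ (a - 1) ^ (-(7 / 8 : ℝ)) :=
    Real.rpow_le_rpow_of_nonpos (by linarith) (by linarith) (by norm_num)
  linarith

/-- `k_e(t) ≤ 1/2` for `t ≥ 2`. [folklore] -/
theorem kernelE_le_half {t : ℝ} (ht : 2 ≤ t) :
    sieveKernel (1 / 2) t * (1 - 1 / t) ^ (-(3 / 8 : ℝ)) ≤ 1 / 2 := by
  have h := kernelE_le_of_le (a := 2) one_lt_two ht
  rw [show (2:ℝ) - 1 = 1 by norm_num, Real.one_rpow] at h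
  linarith

/-- `k_e(t) ≤ 0.398` for `t ≥ 2.3` (`1.3^{7/8} ≥ 1.257`). [folklore] -/
theorem kernelE_le_of_ge_23 {t : ℝ} (ht : 2.3 ≤ t) :
    sieveKernel (1 / 2) t * (1 - 1 / t) ^ (-(3 / 8 : ℝ)) ≤ 0.398 := by
  refine (kernelE_le_of_le (a := 2.3) (by norm_num) ht).trans ?_
  have h1 : (1.257:ℝ) ≤ ((2.3:ℝ) - 1) ^ ((7:ℝ) / 8) := by
    rw [show (2.3:ℝ) - 1 = 1.3 by norm_num]; exact rpow_seven_eighths_ge_one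
  have h2 : ((2.3:ℝ) - 1) ^ (-(7 / 8 : ℝ)) ≤ 1 / 1.257 := by
    rw [show (-(7 / 8 : ℝ)) = -((7:ℝ) / 8) by norm_num, Real.rpow_neg (by norm_num), one_div]
    exact inv_anti₀ (by norm_num) h1
  linarith [h2, show (1:ℝ) / 2 * (1 / 1.257) ≤ 0.398 by norm_num]

/-- `k_e(t) ≤ 0.339` for `t ≥ 2.56` (`1.56^{7/8} ≥ 1.475`). [folklore] -/
theorem kernelE_le_of_ge_256 {t : ℝ} (ht : 2.56 ≤ t) :
    sieveKernel (1 / 2) t * (1 - 1 / t) ^ (-(3 / 8 : ℝ)) ≤ 0.339 := by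
  refine (kernelE_le_of_le (a := 2.56) (by norm_num) ht).trans ?_
  have h1 : (1.475:ℝ) ≤ ((2.56:ℝ) - 1) ^ ((7:ℝ) / 8) := by
    rw [show (2.56:ℝ) - 1 = 1.56 by norm_num]; exact rpow_seven_eighths_ge_two
  have h2 : ((2.56:ℝ) - 1) ^ (-(7 / 8 : ℝ)) ≤ 1 / 1.475 := by
    rw [show (-(7 / 8 : ℝ)) = -((7:ℝ) / 8) by norm_num, Real.rpow_neg (by norm_num), one_div]
    exact inv_anti₀ (by norm_num) h1
  linarith [h2, show (1:ℝ) / 2 * (1 / 1.475) ≤ 0.339 by norm_num]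

/-- `(e/2) k`-bound for `s ≥ 3`: `(1/2)(s − 1)^{−7/8} e ≤ 1` (`2^{7/8} ≥ 1.36 ≥ e/2`). [folklore] -/
theorem half_rpow_mul_exp_le_one {s : ℝ} (hs : 3 ≤ s) :
    (1 / 2) * (s - 1) ^ (-(7 / 8 : ℝ)) * Real.exp 1 ≤ 1 := by
  have h1 : (s - 1) ^ (-(7 / 8 : ℝ)) ≤ (2:ℝ) ^ (-(7 / 8 : ℝ)) :=
    Real.rpow_le_rpow_of_nonpos (by norm_num) (by linarith) (by norm_num)
  have h2 : (2:ℝ) ^ (-(7 / 8 : ℝ)) ≤ 1 / 1.36 := by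
    rw [show (-(7 / 8 : ℝ)) = -((7:ℝ) / 8) by norm_num, Real.rpow_neg (by norm_num), one_div]
    exact inv_anti₀ (by norm_num) two_rpow_seven_eighths_ge
  have h3 := exp_one_le
  have h0 : 0 ≤ (s - 1) ^ (-(7 / 8 : ℝ)) := Real.rpow_nonneg (by linarith) _
  nlinarith [Real.exp_pos (1:ℝ)]

/-- **`k_e(t) ≤ (1/2) · t/(t − 1)²`** for `t > 1`: one half of the kernel of (6.2) for `κ₁ = 1`
(the ratio is `(1 − 1/t)^{9/8} ≤ 1`). [cite: IwaniecActaArith1980, §7 (7.5)] -/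
theorem kernelE_le_half_kOne {t : ℝ} (ht : 1 < t) :
    sieveKernel (1 / 2) t * (1 - 1 / t) ^ (-(3 / 8 : ℝ)) ≤ (1 / 2) * (t / (t - 1) ^ 2) := by
  have ht0 : 0 < t := by linarith
  have hb : 0 < 1 - 1 / t := by rw [sub_pos, div_lt_one ht0]; exact ht
  have h1t : 0 < 1 / t := by positivity
  have hb1 : 1 - 1 / t ≤ 1 := by linarith
  rw [sieveKernel_half_eq ht]
  have e1 : 1 / 2 * (1 - 1 / t) ^ ((3:ℝ) / 2) * (t / (t - 1) ^ 2) * (1 - 1 / t) ^ (-(3 / 8 : ℝ)) =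
      1 / 2 * (t / (t - 1) ^ 2) * (1 - 1 / t) ^ ((9:ℝ) / 8) := by
    rw [show ((9:ℝ) / 8) = (3:ℝ) / 2 + -(3 / 8 : ℝ) by norm_num, Real.rpow_add hb]; ring
  rw [e1]
  have h1 : (1 - 1 / t) ^ ((9:ℝ) / 8) ≤ 1 := Real.rpow_le_one hb.le hb1 (by norm_num)
  have h2 : 0 ≤ t / (t - 1) ^ 2 := div_nonneg ht0.le (sq_nonneg _)
  nlinarith

/-- Continuity of `k_e` on `[a, b]` for `a > 1`. [folklore] -/
theorem continuousOn_kernelE {a b : ℝ} (ha : 1 < a) :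
    ContinuousOn (fun t : ℝ => sieveKernel (1 / 2) t * (1 - 1 / t) ^ (-(3 / 8 : ℝ))) (Icc a b) :=
  (continuousOn_sieveKernel_mul_rpow (1 / 2) (3 / 8)).mono fun t ht => show (1:ℝ) < t by linarith [ht.1]

/-- **`∫_s^U (1/2)(t − 1)^{−7/8} dt = 4((U − 1)^{1/8} − (s − 1)^{1/8})`** for `1 < s ≤ U`. [folklore] -/
theorem integral_half_rpow {s U : ℝ} (hs : 1 < s) (hsU : s ≤ U) :
    ∫ t in s..U, (1 / 2) * (t - 1) ^ (-(7 / 8 : ℝ)) =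
      4 * ((U - 1) ^ ((1:ℝ) / 8) - (s - 1) ^ ((1:ℝ) / 8)) := by
  rw [intervalIntegral.integral_const_mul,
    intervalIntegral.integral_comp_sub_right (fun x => x ^ (-(7 / 8 : ℝ))) 1]
  have h0 : (0:ℝ) ∉ uIcc (s - 1) (U - 1) := by
    rw [uIcc_of_le (by linarith)]
    intro h
    linarith [h.1]
  rw [integral_rpow (Or.inr ⟨by norm_num, h0⟩)]
  norm_num
  ring

/-- `∫_s^U k_e(t) dt ≤ 4((U − 1)^{1/8} − (s − 1)^{1/8})` for `1 < s ≤ U`. [folklore] -/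
theorem integral_kernelE_le {s U : ℝ} (hs : 1 < s) (hsU : s ≤ U) :
    ∫ t in s..U, sieveKernel (1 / 2) t * (1 - 1 / t) ^ (-(3 / 8 : ℝ)) ≤
      4 * ((U - 1) ^ ((1:ℝ) / 8) - (s - 1) ^ ((1:ℝ) / 8)) := by
  rw [← integral_half_rpow hs hsU]
  refine intervalIntegral.integral_mono_on hsU
    ((continuousOn_kernelE hs).mono (by rw [uIcc_of_le hsU])).intervalIntegrable ?_
    fun t ht => kernelE_le_half_rpow (by linarith [ht.1])
  refine (ContinuousOn.intervalIntegrable ?_)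
  rw [uIcc_of_le hsU]
  refine continuousOn_const.mul (ContinuousOn.rpow_const (continuousOn_id.sub continuousOn_const)
    fun t ht => Or.inl ?_)
  have : (1:ℝ) < t := by linarith [ht.1]
  exact ne_of_gt (show (0:ℝ) < id t - 1 by simp only [id_eq]; linarith)

end BetaSieve

end Literature.NumberTheory.Sieve

namespace Literature.NumberTheory.Sieve

namespace BetaSieve

open BetaSieveForward (sieveKernel sieveKernel_nonneg continuousOn_sieveKernel)
open RosserMajorant

/-! ### Integral bounds for the kernel against `Z^±` and `e^{−s}` -/

/-- Integrability of `k_e(t) f(t)` on `[s, U]`, `s > 1`, for `f` continuous on `[s, U]`. [folklore] -/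
theorem intervalIntegrable_kernelE_mul {f : ℝ → ℝ} {s U : ℝ} (hs : 1 < s) (hsU : s ≤ U)
    (hf : ContinuousOn f (Icc s U)) :
    IntervalIntegrable (fun t => sieveKernel (1 / 2) t * (1 - 1 / t) ^ (-(3 / 8 : ℝ)) * f t) volume s U := by
  refine ContinuousOn.intervalIntegrable ?_
  rw [uIcc_of_le hsU]
  exact (continuousOn_kernelE hs).mul hf

/-- **`∫_s^U k_e(t) Z⁺(t − 1) dt ≤ (Z⁻(s) − Z⁻(U))/2`** for `2 ≤ s ≤ U` (kernel comparison and (6.2)).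
[cite: IwaniecActaArith1980, §7 (7.4)–(7.5)] -/
theorem integral_kernelE_zUpper_le {s U : ℝ} (hs : 2 ≤ s) (hsU : s ≤ U) :
    ∫ t in s..U, sieveKernel (1 / 2) t * (1 - 1 / t) ^ (-(3 / 8 : ℝ)) * qUpper 1 2 (t - 1) ≤
      (qLower 1 2 s - qLower 1 2 U) / 2 := by
  rw [zLower_sub_eq hs hsU, ← intervalIntegral.integral_div]
  refine integral_mono_on hsU
    (intervalIntegrable_kernelE_mul (by linarith) hsU
      (continuous_zUpper.comp (continuous_id.sub continuous_const)).continuousOn)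
    ((intervalIntegrable_kOne_mul continuous_zUpper (by linarith) hsU).div_const 2) fun t ht => ?_
  have ht1 : 1 < t := by linarith [ht.1]
  have hz := (zUpper_pos (t - 1)).le
  calc sieveKernel (1 / 2) t * (1 - 1 / t) ^ (-(3 / 8 : ℝ)) * qUpper 1 2 (t - 1)
      ≤ (1 / 2) * (t / (t - 1) ^ 2) * qUpper 1 2 (t - 1) :=
        mul_le_mul_of_nonneg_right (kernelE_le_half_kOne ht1) hz
    _ = t / (t - 1) ^ 2 * qUpper 1 2 (t - 1) / 2 := by ring

/-- **`∫_s^U k_e(t) Z⁻(t − 1) dt ≤ (Z⁺(s) − Z⁺(U))/2`** for `3 ≤ s ≤ U`.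
[cite: IwaniecActaArith1980, §7 (7.4)–(7.5)] -/
theorem integral_kernelE_zLower_le {s U : ℝ} (hs : 3 ≤ s) (hsU : s ≤ U) :
    ∫ t in s..U, sieveKernel (1 / 2) t * (1 - 1 / t) ^ (-(3 / 8 : ℝ)) * qLower 1 2 (t - 1) ≤
      (qUpper 1 2 s - qUpper 1 2 U) / 2 := by
  rw [zUpper_sub_eq hs hsU, ← intervalIntegral.integral_div]
  refine integral_mono_on hsU
    (intervalIntegrable_kernelE_mul (by linarith) hsU
      (continuous_zLower.comp (continuous_id.sub continuous_const)).continuousOn)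
    ((intervalIntegrable_kOne_mul continuous_zLower (by linarith) hsU).div_const 2) fun t ht => ?_
  have ht1 : 1 < t := by linarith [ht.1]
  have hz := (zLower_pos (t - 1)).le
  calc sieveKernel (1 / 2) t * (1 - 1 / t) ^ (-(3 / 8 : ℝ)) * qLower 1 2 (t - 1)
      ≤ (1 / 2) * (t / (t - 1) ^ 2) * qLower 1 2 (t - 1) :=
        mul_le_mul_of_nonneg_right (kernelE_le_half_kOne ht1) hz
    _ = t / (t - 1) ^ 2 * qLower 1 2 (t - 1) / 2 := by ring

/-- `∫_s^U b e^{−(t−1)} dt = b e (e^{−s} − e^{−U}) ≤ b e e^{−s}` (`b ≥ 0`). [folklore] -/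
theorem integral_const_mul_exp_le {b : ℝ} (s U : ℝ) (hb : 0 ≤ b) :
    ∫ t in s..U, b * Real.exp (-(t - 1)) ≤ b * (Real.exp 1 * Real.exp (-s)) := by
  have h1 : ∀ t : ℝ, Real.exp (-(t - 1)) = Real.exp 1 * Real.exp (-t) := fun t => by
    rw [← Real.exp_add]; ring_nf
  have hI : ∫ t in s..U, b * Real.exp (-(t - 1)) = b * (Real.exp 1 * (Real.exp (-s) - Real.exp (-U))) := by
    simp_rw [h1]
    rw [intervalIntegral.integral_const_mul, intervalIntegral.integral_const_mul,
      intervalIntegral.integral_comp_neg (fun x => Real.exp x), integral_exp]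
  rw [hI]
  have h3 : 0 < Real.exp (-U) := Real.exp_pos _
  have h4 : 0 < Real.exp 1 := Real.exp_pos _
  nlinarith [mul_pos h4 h3]

/-- **`∫_s^U k_e(t) e^{−(t−1)} dt ≤ (1/2)(s − 1)^{−7/8} e · e^{−s}`** for `1 < s ≤ U`. [folklore] -/
theorem integral_kernelE_exp_le {s U : ℝ} (hs : 1 < s) (hsU : s ≤ U) :
    ∫ t in s..U, sieveKernel (1 / 2) t * (1 - 1 / t) ^ (-(3 / 8 : ℝ)) * Real.exp (-(t - 1)) ≤
      (1 / 2) * (s - 1) ^ (-(7 / 8 : ℝ)) * (Real.exp 1 * Real.exp (-s)) := by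
  set b := (1 / 2) * (s - 1) ^ (-(7 / 8 : ℝ)) with hb
  have hb0 : 0 ≤ b := mul_nonneg (by norm_num) (Real.rpow_nonneg (by linarith) _)
  have hexpc : Continuous fun t : ℝ => Real.exp (-(t - 1)) :=
    Real.continuous_exp.comp (continuous_id.sub continuous_const).neg
  have hmono : ∫ t in s..U, sieveKernel (1 / 2) t * (1 - 1 / t) ^ (-(3 / 8 : ℝ)) * Real.exp (-(t - 1)) ≤
      ∫ t in s..U, b * Real.exp (-(t - 1)) := by
    refine intervalIntegral.integral_mono_on hsU (intervalIntegrable_kernelE_mul hs hsU hexpc.continuousOn)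
      ((continuous_const.mul hexpc).intervalIntegrable _ _) fun t ht => ?_
    exact mul_le_mul_of_nonneg_right (kernelE_le_of_le hs ht.1) (Real.exp_pos _).le
  exact hmono.trans (integral_const_mul_exp_le s U hb0)

/-- `∫_s^U k_e e^{−(t−1)} ≤ e^{−s}` for `3 ≤ s ≤ U`. [folklore] -/
theorem integral_kernelE_exp_le_of_three {s U : ℝ} (hs : 3 ≤ s) (hsU : s ≤ U) :
    ∫ t in s..U, sieveKernel (1 / 2) t * (1 - 1 / t) ^ (-(3 / 8 : ℝ)) * Real.exp (-(t - 1)) ≤ Real.exp (-s) := by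
  refine (integral_kernelE_exp_le (by linarith) hsU).trans ?_
  have h := half_rpow_mul_exp_le_one hs
  have h0 := Real.exp_pos (-s)
  calc (1 / 2) * (s - 1) ^ (-(7 / 8 : ℝ)) * (Real.exp 1 * Real.exp (-s))
      = ((1 / 2) * (s - 1) ^ (-(7 / 8 : ℝ)) * Real.exp 1) * Real.exp (-s) := by ring
    _ ≤ 1 * Real.exp (-s) := mul_le_mul_of_nonneg_right h h0.le
    _ = Real.exp (-s) := one_mul _

/-- `∫_s^U k_e e^{−(t−1)} ≤ 1.36 e^{−s}` for `2 ≤ s ≤ U`. [folklore] -/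
theorem integral_kernelE_exp_le_of_two {s U : ℝ} (hs : 2 ≤ s) (hsU : s ≤ U) :
    ∫ t in s..U, sieveKernel (1 / 2) t * (1 - 1 / t) ^ (-(3 / 8 : ℝ)) * Real.exp (-(t - 1)) ≤
      1.36 * Real.exp (-s) := by
  refine (integral_kernelE_exp_le (by linarith) hsU).trans ?_
  have h1 : (s - 1) ^ (-(7 / 8 : ℝ)) ≤ 1 := by
    have : (1:ℝ) ^ (-(7 / 8 : ℝ)) = 1 := Real.one_rpow _
    calc (s - 1) ^ (-(7 / 8 : ℝ)) ≤ (1:ℝ) ^ (-(7 / 8 : ℝ)) :=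
          Real.rpow_le_rpow_of_nonpos one_pos (by linarith) (by norm_num)
      _ = 1 := this
  have h0 := Real.exp_pos (-s)
  have h2 := exp_one_le
  have h3 : 0 ≤ (s - 1) ^ (-(7 / 8 : ℝ)) := Real.rpow_nonneg (by linarith) _
  nlinarith [mul_le_mul h1 h2 (Real.exp_pos 1).le zero_le_one, Real.exp_pos (1:ℝ)]

/-- `∫_s^U k_e e^{−(t−1)} ≤ 4.2` for `1 < s ≤ 2`, any `U ≥ s` (`e^{−(t−1)} ≤ 1`, `∫_s^2 k_e ≤ 4`, and
`≤ 1.36 e^{−2}` beyond `2`). [folklore] -/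
theorem integral_kernelE_exp_le_of_le_two {s U : ℝ} (hs : 1 < s) (hs2 : s ≤ 2) (hsU : s ≤ U) :
    ∫ t in s..U, sieveKernel (1 / 2) t * (1 - 1 / t) ^ (-(3 / 8 : ℝ)) * Real.exp (-(t - 1)) ≤ 4.2 := by
  set f := fun t : ℝ => sieveKernel (1 / 2) t * (1 - 1 / t) ^ (-(3 / 8 : ℝ)) * Real.exp (-(t - 1)) with hf
  set U' := max U 2 with hU'
  have hexpc : Continuous fun t : ℝ => Real.exp (-(t - 1)) :=
    Real.continuous_exp.comp (continuous_id.sub continuous_const).neg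
  have hint : ∀ a b : ℝ, 1 < a → a ≤ b → IntervalIntegrable f volume a b := fun a b ha hab =>
    intervalIntegrable_kernelE_mul ha hab hexpc.continuousOn
  have hf0 : ∀ t, 1 < t → 0 ≤ f t := fun t ht => mul_nonneg (kernelE_nonneg ht) (Real.exp_pos _).le
  have hsU' : s ≤ U' := hsU.trans (le_max_left _ _)
  have h1 : ∫ t in s..U, f t ≤ ∫ t in s..U', f t :=
    intervalIntegral.integral_mono_interval le_rfl hsU (le_max_left _ _)
      ((ae_restrict_mem measurableSet_Ioc).mono fun t ht => hf0 t (by linarith [ht.1])) (hint s U' hs hsU')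
  have h2 : ∫ t in s..U', f t = (∫ t in s..(2:ℝ), f t) + ∫ t in (2:ℝ)..U', f t :=
    (intervalIntegral.integral_add_adjacent_intervals (hint s 2 hs hs2) (hint 2 U' one_lt_two (le_max_right _ _))).symm
  have h3 : ∫ t in s..(2:ℝ), f t ≤ 4 * (((2:ℝ) - 1) ^ ((1:ℝ) / 8) - (s - 1) ^ ((1:ℝ) / 8)) := by
    refine le_trans ?_ (integral_kernelE_le hs hs2)
    refine intervalIntegral.integral_mono_on hs2 (hint s 2 hs hs2)
      ((continuousOn_kernelE hs).mono (by rw [uIcc_of_le hs2])).intervalIntegrable fun t ht => ?_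
    have hk := kernelE_nonneg (show (1:ℝ) < t by linarith [ht.1])
    have he : Real.exp (-(t - 1)) ≤ 1 := by rw [Real.exp_le_one_iff]; linarith [ht.1]
    calc f t = sieveKernel (1 / 2) t * (1 - 1 / t) ^ (-(3 / 8 : ℝ)) * Real.exp (-(t - 1)) := rfl
      _ ≤ sieveKernel (1 / 2) t * (1 - 1 / t) ^ (-(3 / 8 : ℝ)) * 1 := mul_le_mul_of_nonneg_left he hk
      _ = _ := mul_one _
  have h4 : ∫ t in (2:ℝ)..U', f t ≤ 1.36 * Real.exp (-2) := integral_kernelE_exp_le_of_two le_rfl (le_max_right _ _)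
  have h5 : (s - 1) ^ ((1:ℝ) / 8) ≥ 0 := Real.rpow_nonneg (by linarith) _
  have h6 : ((2:ℝ) - 1) ^ ((1:ℝ) / 8) = 1 := by norm_num
  rw [h6] at h3
  linarith [exp_neg_two_le]

/-- **`Z⁻(4) ≤ 3/25`** (`Z⁻(4) = 2/3 − (log 3)/2`: two steps of (6.2) with `Z⁺ = 1/2` on `[1, 3]`).
[cite: IwaniecActaArith1980, §6 (6.2)] -/
theorem zLower_four_le : qLower 1 2 4 ≤ 3 / 25 := by
  have h := zLower_sub_eq (s := 3) (s' := 4) (by norm_num) (by norm_num)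
  have hI : ∫ t in (3:ℝ)..4, t / (t - 1) ^ 2 * qUpper 1 2 (t - 1) = (Real.log (3 / 2) + 1 / 6) / 2 := by
    have hc : ∫ t in (3:ℝ)..4, t / (t - 1) ^ 2 * qUpper 1 2 (t - 1) = ∫ t in (3:ℝ)..4, t / (t - 1) ^ 2 * (1 / 2) := by
      refine intervalIntegral.integral_congr fun t ht => ?_
      rw [uIcc_of_le (by norm_num)] at ht
      show t / (t - 1) ^ 2 * qUpper 1 2 (t - 1) = t / (t - 1) ^ 2 * (1 / 2)
      rw [zUpper_eq (by linarith [ht.2])]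
    have hK : ∫ t in (3:ℝ)..4, t / (t - 1) ^ 2 = Real.log (3 / 2) + 1 / 6 := by
      rw [integral_kOne (by norm_num) (by norm_num)]
      have : Real.log (4 - 1) - Real.log (3 - 1) = Real.log (3 / 2) := by
        rw [← Real.log_div (by norm_num) (by norm_num)]; norm_num
      linarith
    rw [hc, intervalIntegral.integral_mul_const, hK]
    ring
  rw [hI, zLower_three] at h
  have hl3 : Real.log (3 / 2) = Real.log 3 - Real.log 2 := Real.log_div (by norm_num) (by norm_num)
  rw [hl3] at h
  linarith [log_three_ge]

/-- **`∫_s^U k_e(t) Z⁺(t − 1) dt ≤ 2(3^{1/8} − (s − 1)^{1/8}) + 3/50`** for `1 < s ≤ 2`, any `U ≥ s`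
(`Z⁺ = 1/2` on `[0, 3]`, `∫_s^4 k_e ≤ 4(3^{1/8} − (s − 1)^{1/8})`, and `∫_4^∞ k_e Z⁺(t − 1) ≤ Z⁻(4)/2`).
[cite: IwaniecActaArith1980, §7 (7.5)] -/
theorem integral_kernelE_zUpper_le_of_le_two {s U : ℝ} (hs : 1 < s) (hs2 : s ≤ 2) (hsU : s ≤ U) :
    ∫ t in s..U, sieveKernel (1 / 2) t * (1 - 1 / t) ^ (-(3 / 8 : ℝ)) * qUpper 1 2 (t - 1) ≤
      2 * ((3:ℝ) ^ ((1:ℝ) / 8) - (s - 1) ^ ((1:ℝ) / 8)) + 3 / 50 := by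
  set f := fun t : ℝ => sieveKernel (1 / 2) t * (1 - 1 / t) ^ (-(3 / 8 : ℝ)) * qUpper 1 2 (t - 1) with hf
  set U' := max U 4 with hU'
  have hzc : Continuous fun t : ℝ => qUpper 1 2 (t - 1) := continuous_zUpper.comp (continuous_id.sub continuous_const)
  have hint : ∀ a b : ℝ, 1 < a → a ≤ b → IntervalIntegrable f volume a b := fun a b ha hab =>
    intervalIntegrable_kernelE_mul ha hab hzc.continuousOn
  have hf0 : ∀ t, 1 < t → 0 ≤ f t := fun t ht => mul_nonneg (kernelE_nonneg ht) (zUpper_pos _).le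
  have hs4 : s ≤ 4 := by linarith
  have hsU' : s ≤ U' := hsU.trans (le_max_left _ _)
  have h1 : ∫ t in s..U, f t ≤ ∫ t in s..U', f t :=
    intervalIntegral.integral_mono_interval le_rfl hsU (le_max_left _ _)
      ((ae_restrict_mem measurableSet_Ioc).mono fun t ht => hf0 t (by linarith [ht.1])) (hint s U' hs hsU')
  have h2 : ∫ t in s..U', f t = (∫ t in s..(4:ℝ), f t) + ∫ t in (4:ℝ)..U', f t :=
    (intervalIntegral.integral_add_adjacent_intervals (hint s 4 hs hs4)
      (hint 4 U' (by norm_num) (le_max_right _ _))).symm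
  have h3 : ∫ t in s..(4:ℝ), f t ≤ (1 / 2) * (4 * (((4:ℝ) - 1) ^ ((1:ℝ) / 8) - (s - 1) ^ ((1:ℝ) / 8))) := by
    have hc : ∫ t in s..(4:ℝ), f t = (1 / 2) * ∫ t in s..(4:ℝ), sieveKernel (1 / 2) t * (1 - 1 / t) ^ (-(3 / 8 : ℝ)) := by
      rw [← intervalIntegral.integral_const_mul]
      refine intervalIntegral.integral_congr fun t ht => ?_
      rw [uIcc_of_le hs4] at ht
      simp only [hf]
      rw [zUpper_eq (by linarith [ht.2])]
      ring
    rw [hc]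
    exact mul_le_mul_of_nonneg_left (integral_kernelE_le hs hs4) (by norm_num)
  have h4 : ∫ t in (4:ℝ)..U', f t ≤ (qLower 1 2 4 - qLower 1 2 U') / 2 :=
    integral_kernelE_zUpper_le (by norm_num) (le_max_right _ _)
  have h5 := zLower_four_le
  have h6 := (zLower_pos U').le
  rw [show (4:ℝ) - 1 = 3 by norm_num] at h3
  linarith

end BetaSieve

end Literature.NumberTheory.Sieve

namespace Literature.NumberTheory.Sieve

namespace BetaSieve

open BetaSieveForward (sieveKernel sieveKernel_nonneg continuousOn_sieveKernel)
open RosserMajorant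

/-! ### The numerical heart: `∫_2^3 k_e(t) H⁻(t − 1) dt` -/

/-- One piece of the step-function bound: on `[a, b] ⊆ [2, 3]`, if `k_e ≤ k` and the profile
`4.712 − 4(t − 2)^{1/8}` is at most `m ≥ 1`, then `∫_a^b k_e(t) W(t − 1) dt ≤ (b − a) k (h m + 5)` for any
continuous `W` with `W(v) ≤ h max(1, 4.712 − 4(v − 1)^{1/8}) + 5` on `[1, 2]`. [folklore] -/
theorem integral_piece_le {h k m a b : ℝ} {W : ℝ → ℝ} (hh : 0 ≤ h) (ha2 : 2 ≤ a) (hab : a ≤ b) (hb3 : b ≤ 3)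
    (hWc : Continuous W)
    (hW : ∀ v : ℝ, 1 ≤ v → v ≤ 2 → W v ≤ h * max 1 (4.712 - 4 * (v - 1) ^ ((1:ℝ) / 8)) + 5)
    (hk : ∀ t : ℝ, a ≤ t → t ≤ b → sieveKernel (1 / 2) t * (1 - 1 / t) ^ (-(3 / 8 : ℝ)) ≤ k) (hm1 : 1 ≤ m)
    (hm : ∀ t : ℝ, a ≤ t → t ≤ b → 4.712 - 4 * (t - 2) ^ ((1:ℝ) / 8) ≤ m) :
    ∫ t in a..b, sieveKernel (1 / 2) t * (1 - 1 / t) ^ (-(3 / 8 : ℝ)) * W (t - 1) ≤ (b - a) * (k * (h * m + 5)) := by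
  have ha1 : 1 < a := by linarith
  have hint := intervalIntegrable_kernelE_mul (f := fun t => W (t - 1)) ha1 hab
    (hWc.comp (continuous_id.sub continuous_const)).continuousOn
  have hmono : ∫ t in a..b, sieveKernel (1 / 2) t * (1 - 1 / t) ^ (-(3 / 8 : ℝ)) * W (t - 1) ≤
      ∫ _ in a..b, k * (h * m + 5) := by
    refine intervalIntegral.integral_mono_on hab hint intervalIntegrable_const fun t ht => ?_
    have ht1 : 1 < t := by linarith [ht.1]
    have hk0 := kernelE_nonneg ht1
    have hWt := hW (t - 1) (by linarith [ht.1]) (by linarith [ht.2])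
    rw [show t - 1 - 1 = t - 2 by ring] at hWt
    have hmax : max 1 (4.712 - 4 * (t - 2) ^ ((1:ℝ) / 8)) ≤ m := max_le hm1 (hm t ht.1 ht.2)
    have hWle : W (t - 1) ≤ h * m + 5 := hWt.trans (by nlinarith)
    have hpos : 0 ≤ h * m + 5 := by nlinarith
    calc sieveKernel (1 / 2) t * (1 - 1 / t) ^ (-(3 / 8 : ℝ)) * W (t - 1)
        ≤ sieveKernel (1 / 2) t * (1 - 1 / t) ^ (-(3 / 8 : ℝ)) * (h * m + 5) := mul_le_mul_of_nonneg_left hWle hk0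
      _ ≤ k * (h * m + 5) := mul_le_mul_of_nonneg_right (hk t ht.1 ht.2) hpos
  rw [intervalIntegral.integral_const, smul_eq_mul] at hmono
  exact hmono

/-- **`∫_2^3 k_e(t) W(t − 1) dt ≤ 0.5913 h + 2.0132`** for a continuous `W` with
`W(v) ≤ h max(1, 4.712 − 4(v − 1)^{1/8}) + 5` on `[1, 2]` (`h ≥ 0`): a five-piece step-function bound
(break points `2.01, 2.1, 2.3, 2.56`; `k_e ≤ 1/2` on `[2, 2.3]`, `≤ 0.398` on `[2.3, 2.56]`, `≤ 0.339` on
`[2.56, 3]`; profile values `4.712, 2.472, 1.752, 1.276, 1`). [folklore] -/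
theorem integral_two_three_le {h : ℝ} (hh : 0 ≤ h) {W : ℝ → ℝ} (hWc : Continuous W)
    (hW : ∀ v : ℝ, 1 ≤ v → v ≤ 2 → W v ≤ h * max 1 (4.712 - 4 * (v - 1) ^ ((1:ℝ) / 8)) + 5) :
    ∫ t in (2:ℝ)..3, sieveKernel (1 / 2) t * (1 - 1 / t) ^ (-(3 / 8 : ℝ)) * W (t - 1) ≤ 0.5913 * h + 2.0132 := by
  set f := fun t : ℝ => sieveKernel (1 / 2) t * (1 - 1 / t) ^ (-(3 / 8 : ℝ)) * W (t - 1) with hf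
  have hint : ∀ a b : ℝ, 2 ≤ a → a ≤ b → IntervalIntegrable f volume a b := fun a b ha hab =>
    intervalIntegrable_kernelE_mul (f := fun t => W (t - 1)) (by linarith) hab
      (hWc.comp (continuous_id.sub continuous_const)).continuousOn
  -- profile bounds from lower bounds of `(t - 2)^{1/8}`
  have hprof : ∀ {t a c : ℝ}, 0 ≤ a → a ≤ t - 2 → c ≤ a ^ ((1:ℝ) / 8) →
      4.712 - 4 * (t - 2) ^ ((1:ℝ) / 8) ≤ 4.712 - 4 * c := by
    intro t a c ha hat hc
    have : a ^ ((1:ℝ) / 8) ≤ (t - 2) ^ ((1:ℝ) / 8) := Real.rpow_le_rpow ha hat (by norm_num)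
    linarith
  have hk_half : ∀ t : ℝ, 2 ≤ t → sieveKernel (1 / 2) t * (1 - 1 / t) ^ (-(3 / 8 : ℝ)) ≤ 1 / 2 :=
    fun t ht => kernelE_le_half ht
  -- the five pieces
  have p1 : ∫ t in (2:ℝ)..2.01, f t ≤ (2.01 - 2) * (1 / 2 * (h * 4.712 + 5)) :=
    integral_piece_le hh le_rfl (by norm_num) (by norm_num) hWc hW (fun t ht _ => hk_half t ht) (by norm_num)
      (fun t ht _ => by
        have : 0 ≤ (t - 2) ^ ((1:ℝ) / 8) := Real.rpow_nonneg (by linarith) _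
        linarith)
  have p2 : ∫ t in (2.01:ℝ)..2.1, f t ≤ (2.1 - 2.01) * (1 / 2 * (h * 2.472 + 5)) :=
    integral_piece_le hh (by norm_num) (by norm_num) (by norm_num) hWc hW (fun t ht _ => hk_half t (by linarith))
      (by norm_num)
      (fun t ht _ => (hprof (a := 0.01) (by norm_num) (by linarith) rpow_eighth_ge_one).trans (by norm_num))
  have p3 : ∫ t in (2.1:ℝ)..2.3, f t ≤ (2.3 - 2.1) * (1 / 2 * (h * 1.752 + 5)) :=
    integral_piece_le hh (by norm_num) (by norm_num) (by norm_num) hWc hW (fun t ht _ => hk_half t (by linarith))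
      (by norm_num)
      (fun t ht _ => (hprof (a := 0.1) (by norm_num) (by linarith) rpow_eighth_ge_two).trans (by norm_num))
  have p4 : ∫ t in (2.3:ℝ)..2.56, f t ≤ (2.56 - 2.3) * (0.398 * (h * 1.276 + 5)) :=
    integral_piece_le hh (by norm_num) (by norm_num) (by norm_num) hWc hW (fun t ht _ => kernelE_le_of_ge_23 ht)
      (by norm_num)
      (fun t ht _ => (hprof (a := 0.3) (by norm_num) (by linarith) rpow_eighth_ge_three).trans (by norm_num))
  have p5 : ∫ t in (2.56:ℝ)..3, f t ≤ (3 - 2.56) * (0.339 * (h * 1 + 5)) :=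
    integral_piece_le hh (by norm_num) (by norm_num) le_rfl hWc hW (fun t ht _ => kernelE_le_of_ge_256 ht)
      le_rfl
      (fun t ht _ => (hprof (a := 0.56) (by norm_num) (by linarith) rpow_eighth_ge_four).trans (by norm_num))
  -- glue
  have e1 : ∫ t in (2:ℝ)..3, f t = (∫ t in (2:ℝ)..2.01, f t) + ∫ t in (2.01:ℝ)..3, f t :=
    (intervalIntegral.integral_add_adjacent_intervals (hint 2 2.01 le_rfl (by norm_num))
      (hint 2.01 3 (by norm_num) (by norm_num))).symm
  have e2 : ∫ t in (2.01:ℝ)..3, f t = (∫ t in (2.01:ℝ)..2.1, f t) + ∫ t in (2.1:ℝ)..3, f t :=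
    (intervalIntegral.integral_add_adjacent_intervals (hint 2.01 2.1 (by norm_num) (by norm_num))
      (hint 2.1 3 (by norm_num) (by norm_num))).symm
  have e3 : ∫ t in (2.1:ℝ)..3, f t = (∫ t in (2.1:ℝ)..2.3, f t) + ∫ t in (2.3:ℝ)..3, f t :=
    (intervalIntegral.integral_add_adjacent_intervals (hint 2.1 2.3 (by norm_num) (by norm_num))
      (hint 2.3 3 (by norm_num) (by norm_num))).symm
  have e4 : ∫ t in (2.3:ℝ)..3, f t = (∫ t in (2.3:ℝ)..2.56, f t) + ∫ t in (2.56:ℝ)..3, f t :=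
    (intervalIntegral.integral_add_adjacent_intervals (hint 2.3 2.56 (by norm_num) (by norm_num))
      (hint 2.56 3 (by norm_num) (by norm_num))).symm
  rw [e1, e2, e3, e4]
  linarith

/-! ### The majorant package at `β = 1` -/

set_option maxHeartbeats 800000 in
/-- **The majorant package for the half-dimensional sieve (`κ = 1/2`, `β = 1`, loss exponent `3/8`).**
For every `ε₁ > 0` there are functions `H⁺, H⁻` (namely `H⁺ = 2h Z⁺ + e^{−s}` and `H⁻ = h Z⁻ + e^{−s}` on
`[2, ∞)`, `H⁻ = max(h + e^{−s}, h ψ(max(s,1)) + 5)` on `(−∞, 2]`, `ψ(σ) = 4(3^{1/8} − (σ − 1)^{1/8}) + 3/25`,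
with the linear-sieve majorants `Z^± = qUpper/qLower 1 2` of §6 and a large constant `h`) and constants
`R, c₀` such that: `H^± > 0`, non-increasing and continuous on `ℝ`; the Lemma-20 kernel
`k_e(t) = k(t)(1 − 1/t)^{−3/8}` (`k = sieveKernel (1/2)`) satisfies `∫_s^U k_e H⁺(· − 1) ≤ (1 + ε₁) H⁻(s)`
(`1 < s`) and `∫_s^U k_e H⁻(· − 1) ≤ (1 + ε₁) H⁺(s)` (`2 ≤ s`) (Iwaniec's (7.5) for `κ ≤ 1/2`, here with the
comparison `k_e ≤ (1/2) t/(t − 1)²` against (6.2) for `κ₁ = 1` and a numerical verification on `[2, 3]`);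
the one-step ratios `H⁺(s − 1) ≤ R H⁻(s)` (`s ≥ 1`), `H⁻(s − 1) ≤ R H⁺(s)` (`s ≥ 2`); Lemma 17 at
`κ = 1/2` (`RosserSieveHalfLemma17.exists_const_contT_le_half`) in the form `T⁻_N ≤ c₀ H⁻` (`s ≥ 1`),
`T⁺_N ≤ c₀ H⁺` (`s ≥ 0`); and `e^{−s} ≤ H^±(s)`. These are the analytic inputs of the main-term induction at
`β = 1`. [cite: IwaniecActaArith1980, §7 (7.5)–(7.6) and Lemma 17] -/
theorem exists_majorant_package_one {ε₁ : ℝ} (hε₁ : 0 < ε₁) :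
    ∃ (Hp Hm : ℝ → ℝ) (R c₀ : ℝ),
      (∀ s, 0 < Hp s ∧ 0 < Hm s) ∧ Antitone Hp ∧ Antitone Hm ∧ Continuous Hp ∧ Continuous Hm ∧
      (∀ s U : ℝ, 1 < s → s ≤ U →
        ∫ t in s..U, sieveKernel (1 / 2) t * (1 - 1 / t) ^ (-(3 / 8 : ℝ)) * Hp (t - 1) ≤ (1 + ε₁) * Hm s) ∧
      (∀ s U : ℝ, 2 ≤ s → s ≤ U →
        ∫ t in s..U, sieveKernel (1 / 2) t * (1 - 1 / t) ^ (-(3 / 8 : ℝ)) * Hm (t - 1) ≤ (1 + ε₁) * Hp s) ∧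
      (∀ s, 1 ≤ s → Hp (s - 1) ≤ R * Hm s) ∧ (∀ s, 2 ≤ s → Hm (s - 1) ≤ R * Hp s) ∧
      (∀ (N : ℕ) (u : ℝ), (1 ≤ u → contT 0 (1 / 2) 1 N u ≤ c₀ * Hm u) ∧
        (0 ≤ u → contT 1 (1 / 2) 1 N u ≤ c₀ * Hp u)) ∧
      (∀ s, Real.exp (-s) ≤ Hp s ∧ Real.exp (-s) ≤ Hm s) := by
  -- the constant `h`
  set h : ℝ := max 20 (1 / ε₁) with hhdef
  have hh20 : 20 ≤ h := le_max_left _ _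
  have hhε : 1 / ε₁ ≤ h := le_max_right _ _
  have hh0 : 0 < h := by linarith
  have hh1 : 1 ≤ h := by linarith
  have hgrow : ∀ x : ℝ, 0 ≤ x → x ≤ (1 + ε₁) * x := fun x hx => le_mul_of_one_le_left hx (by linarith)
  -- basic functions
  set E : ℝ → ℝ := fun s => Real.exp (-s) with hE
  set ψ : ℝ → ℝ := fun σ => 4 * ((3:ℝ) ^ ((1:ℝ) / 8) - (σ - 1) ^ ((1:ℝ) / 8)) + 3 / 25 with hψ
  set W : ℝ → ℝ := fun s => max (h + E s) (h * ψ (max s 1) + 5) with hW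
  set A : ℝ → ℝ := fun s => h * qLower 1 2 s + E s with hA
  set Hp : ℝ → ℝ := fun s => 2 * h * qUpper 1 2 s + E s with hHp
  obtain ⟨Hm, hHm⟩ : ∃ Hm : ℝ → ℝ, ∀ s, Hm s = if s ≤ 2 then W s else A s :=
    ⟨fun s => if s ≤ 2 then W s else A s, fun s => rfl⟩
  have hEpos : ∀ s, 0 < E s := fun s => Real.exp_pos _
  have hE_anti : Antitone E := fun a b hab => Real.exp_le_exp.mpr (neg_le_neg hab)
  have hEc : Continuous E := Real.continuous_exp.comp continuous_neg
  have hE_le_one : ∀ s, 0 ≤ s → E s ≤ 1 := fun s hs => by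
    simp only [hE]; rw [Real.exp_le_one_iff]; linarith
  have hZp := zUpper_pos
  have hZm := zLower_pos
  have hZp_anti : Antitone (qUpper 1 2) := qUpper_antitone (κ := 1) (β := 2) zero_le_one one_lt_two zLower_pos
  have hZm_anti : Antitone (qLower 1 2) := qLower_antitone (κ := 1) (β := 2) zero_le_one one_lt_two zUpper_pos
  have h38 := three_rpow_eighth_le
  -- `ψ`
  have hψ_anti : ∀ {σ σ' : ℝ}, 1 ≤ σ → σ ≤ σ' → ψ σ' ≤ ψ σ := by
    intro σ σ' h1 h2
    simp only [hψ]
    have : (σ - 1) ^ ((1:ℝ) / 8) ≤ (σ' - 1) ^ ((1:ℝ) / 8) := Real.rpow_le_rpow (by linarith) (by linarith) (by norm_num)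
    linarith
  have hψ_le : ∀ σ : ℝ, ψ σ ≤ 4.712 - 4 * (σ - 1) ^ ((1:ℝ) / 8) := by
    intro σ; simp only [hψ]; linarith
  have hψ2 : ψ 2 ≤ 0.712 := by
    have := hψ_le 2
    rw [show (2:ℝ) - 1 = 1 by norm_num, Real.one_rpow] at this
    linarith
  have hψc : Continuous fun s : ℝ => ψ (max s 1) := by
    simp only [hψ]
    exact (continuous_const.mul (continuous_const.sub ((Real.continuous_rpow_const (by norm_num)).comp
      ((continuous_id.max continuous_const).sub continuous_const)))).add continuous_const
  -- `W`, `A`, `Hp`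
  have hWc : Continuous W := by
    simp only [hW]
    exact (continuous_const.add hEc).max ((continuous_const.mul hψc).add continuous_const)
  have hAc : Continuous A := (continuous_const.mul continuous_zLower).add hEc
  have hHpc : Continuous Hp := (continuous_const.mul continuous_zUpper).add hEc
  have hW_anti : Antitone W := by
    intro a b hab
    simp only [hW]
    refine max_le_max (by linarith [hE_anti hab]) ?_
    have : ψ (max b 1) ≤ ψ (max a 1) := hψ_anti (le_max_right _ _) (max_le_max hab le_rfl)
    nlinarith
  have hA_anti : Antitone A := fun a b hab =>
    add_le_add (mul_le_mul_of_nonneg_left (hZm_anti hab) hh0.le) (hE_anti hab)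
  have hHp_anti : Antitone Hp := fun a b hab =>
    add_le_add (mul_le_mul_of_nonneg_left (hZp_anti hab) (by linarith)) (hE_anti hab)
  have hW_ge : ∀ s, h + E s ≤ W s := fun s => le_max_left _ _
  have hW_ge' : ∀ s, h * ψ (max s 1) + 5 ≤ W s := fun s => le_max_right _ _
  have hWpos : ∀ s, 0 < W s := fun s => lt_of_lt_of_le (by linarith [hEpos s]) (hW_ge s)
  have hApos : ∀ s, 0 < A s := fun s => by
    simp only [hA]; exact add_pos (mul_pos hh0 (hZm s)) (hEpos s)
  -- the junction at `2`
  have hW2 : W 2 = h + E 2 := by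
    simp only [hW]
    refine max_eq_left ?_
    rw [max_eq_left (by norm_num : (1:ℝ) ≤ 2)]
    have := hEpos 2
    nlinarith
  have hA2 : A 2 = h + E 2 := by simp only [hA]; rw [zLower_eq le_rfl, mul_one]
  have hHm_le : ∀ s, s ≤ 2 → Hm s = W s := fun s hs => by rw [hHm s, if_pos hs]
  have hHm_ge : ∀ s, 2 ≤ s → Hm s = A s := by
    intro s hs
    rcases hs.lt_or_eq with hlt | heq
    · rw [hHm s, if_neg (not_le.mpr hlt)]
    · rw [← heq, hHm_le 2 le_rfl, hW2, hA2]
  have hHmc : Continuous Hm := by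
    rw [show Hm = fun s => if s ≤ 2 then W s else A s from funext hHm]
    exact Continuous.if_le hWc hAc continuous_id continuous_const (fun x hx => by rw [hx]; exact hW2.trans hA2.symm)
  have hHm_anti : Antitone Hm := by
    intro a b hab
    rcases le_or_gt b 2 with hb | hb
    · rw [hHm_le b hb, hHm_le a (hab.trans hb)]; exact hW_anti hab
    · rw [hHm_ge b hb.le]
      rcases le_or_gt a 2 with ha | ha
      · rw [hHm_le a ha]
        calc A b ≤ A 2 := hA_anti hb.le
          _ = W 2 := hA2.trans hW2.symm
          _ ≤ W a := hW_anti ha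
      · rw [hHm_ge a ha.le]; exact hA_anti hab
  have hHmpos : ∀ s, 0 < Hm s := fun s => by
    rcases le_or_gt s 2 with hs | hs
    · rw [hHm_le s hs]; exact hWpos s
    · rw [hHm_ge s hs.le]; exact hApos s
  have hHppos : ∀ s, 0 < Hp s := fun s => by
    simp only [hHp]; exact add_pos (mul_pos (by linarith) (hZp s)) (hEpos s)
  have hHm_ge_E : ∀ s, E s ≤ Hm s := fun s => by
    rcases le_or_gt s 2 with hs | hs
    · rw [hHm_le s hs]; exact le_trans (by linarith) (hW_ge s)
    · rw [hHm_ge s hs.le]; simp only [hA]; linarith [mul_pos hh0 (hZm s)]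
  have hHp_ge_E : ∀ s, E s ≤ Hp s := fun s => by
    simp only [hHp]; linarith [mul_pos hh0 (hZp s)]
  have hHm_ge_Z : ∀ s, 1 ≤ s → h * qLower 1 2 s ≤ Hm s := fun s hs1 => by
    rcases le_or_gt s 2 with hs | hs
    · rw [hHm_le s hs, zLower_eq hs, mul_one]; exact le_trans (by linarith [hEpos s]) (hW_ge s)
    · rw [hHm_ge s hs.le]; simp only [hA]; linarith [hEpos s]
  have hHp_ge_Z : ∀ s, qUpper 1 2 s ≤ Hp s := fun s => by
    simp only [hHp]; nlinarith [hZp s, hEpos s]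
  -- the `W`-profile hypothesis of the numerical lemma
  have hWprof : ∀ v : ℝ, 1 ≤ v → v ≤ 2 → W v ≤ h * max 1 (4.712 - 4 * (v - 1) ^ ((1:ℝ) / 8)) + 5 := by
    intro v hv1 hv2
    simp only [hW]
    rw [max_eq_left hv1]
    refine max_le ?_ ?_
    · have h1 : h * 1 ≤ h * max 1 (4.712 - 4 * (v - 1) ^ ((1:ℝ) / 8)) :=
        mul_le_mul_of_nonneg_left (le_max_left _ _) hh0.le
      linarith [hE_le_one v (by linarith)]
    · have h1 : h * ψ v ≤ h * max 1 (4.712 - 4 * (v - 1) ^ ((1:ℝ) / 8)) :=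
        mul_le_mul_of_nonneg_left ((hψ_le v).trans (le_max_right _ _)) hh0.le
      linarith
  -- splitting integrals of `k_e (c Z(t-1) + E(t-1))`
  have hsplit : ∀ (c : ℝ) (Z : ℝ → ℝ), Continuous Z → ∀ {s U : ℝ}, 1 < s → s ≤ U →
      ∫ t in s..U, sieveKernel (1 / 2) t * (1 - 1 / t) ^ (-(3 / 8 : ℝ)) * (c * Z (t - 1) + E (t - 1)) =
        c * (∫ t in s..U, sieveKernel (1 / 2) t * (1 - 1 / t) ^ (-(3 / 8 : ℝ)) * Z (t - 1)) +
          ∫ t in s..U, sieveKernel (1 / 2) t * (1 - 1 / t) ^ (-(3 / 8 : ℝ)) * Real.exp (-(t - 1)) := by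
    intro c Z hZc s U hs hsU
    have hi1 := intervalIntegrable_kernelE_mul (f := fun t => Z (t - 1)) hs hsU
      (hZc.comp (continuous_id.sub continuous_const)).continuousOn
    have hi2 := intervalIntegrable_kernelE_mul (f := fun t => Real.exp (-(t - 1))) hs hsU
      (Real.continuous_exp.comp (continuous_id.sub continuous_const).neg).continuousOn
    rw [← intervalIntegral.integral_const_mul, ← intervalIntegral.integral_add (hi1.const_mul c) hi2]
    refine intervalIntegral.integral_congr fun t _ => ?_
    simp only [hE]; ring
  -- decay thresholds for the ratio bounds
  obtain ⟨u₁, hu₁⟩ := eventually_atTop.mp (majorantHyp_one_two.eventually_qUpper_le 3)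
  obtain ⟨u₂, hu₂⟩ := eventually_atTop.mp (majorantHyp_one_two.eventually_qLower_le 3)
  set s₁ : ℝ := max (max u₁ u₂ + 1) 3 with hs₁
  set R : ℝ := max (2 * h + Real.exp 1) (max (Hp 0 / Hm s₁) (Hm 1 / Hp s₁)) with hR
  obtain ⟨c, hc, hbd⟩ := exists_const_contT_le_half
  refine ⟨Hp, Hm, R, c, fun s => ⟨hHppos s, hHmpos s⟩, hHp_anti, hHm_anti, hHpc, hHmc, ?_, ?_, ?_, ?_, ?_,
    fun s => ⟨hHp_ge_E s, hHm_ge_E s⟩⟩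
  · -- (H1): `∫_s^U k_e H⁺(t-1) ≤ (1+ε₁) H⁻(s)` for `1 < s`
    intro s U hs hsU
    have hI := hsplit (2 * h) (qUpper 1 2) continuous_zUpper hs hsU
    simp only [hHp] at hI ⊢
    rw [hI]
    clear hI
    rcases le_or_gt s 2 with hs2 | hs2
    · -- `1 < s ≤ 2`
      rw [hHm_le s hs2]
      have h1 := integral_kernelE_zUpper_le_of_le_two hs hs2 hsU
      have h2 := integral_kernelE_exp_le_of_le_two hs hs2 hsU
      have hWs : h * ψ s + 5 ≤ W s := by
        have := hW_ge' s; rwa [max_eq_left hs.le] at this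
      have hW0 := (hWpos s).le
      have hkey : 2 * h * (2 * ((3:ℝ) ^ ((1:ℝ) / 8) - (s - 1) ^ ((1:ℝ) / 8)) + 3 / 50) = h * ψ s := by
        simp only [hψ]; ring
      calc 2 * h * (∫ t in s..U, sieveKernel (1 / 2) t * (1 - 1 / t) ^ (-(3 / 8 : ℝ)) * qUpper 1 2 (t - 1)) +
            ∫ t in s..U, sieveKernel (1 / 2) t * (1 - 1 / t) ^ (-(3 / 8 : ℝ)) * Real.exp (-(t - 1))
          ≤ 2 * h * (2 * ((3:ℝ) ^ ((1:ℝ) / 8) - (s - 1) ^ ((1:ℝ) / 8)) + 3 / 50) + 4.2 :=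
            add_le_add (mul_le_mul_of_nonneg_left h1 (by linarith)) h2
        _ = h * ψ s + 4.2 := by rw [hkey]
        _ ≤ W s := by linarith
        _ ≤ (1 + ε₁) * W s := hgrow _ hW0
    · -- `s > 2`
      rw [hHm_ge s hs2.le]
      have h1 := integral_kernelE_zUpper_le hs2.le hsU
      have hZU := (hZm U).le
      simp only [hA]
      rcases le_or_gt 3 s with hs3 | hs3
      · have h2 := integral_kernelE_exp_le_of_three hs3 hsU
        have hpos : 0 ≤ h * qLower 1 2 s + E s := (hApos s).le
        calc 2 * h * (∫ t in s..U, sieveKernel (1 / 2) t * (1 - 1 / t) ^ (-(3 / 8 : ℝ)) * qUpper 1 2 (t - 1)) +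
              ∫ t in s..U, sieveKernel (1 / 2) t * (1 - 1 / t) ^ (-(3 / 8 : ℝ)) * Real.exp (-(t - 1))
            ≤ 2 * h * ((qLower 1 2 s - qLower 1 2 U) / 2) + Real.exp (-s) :=
              add_le_add (mul_le_mul_of_nonneg_left h1 (by linarith)) h2
          _ ≤ h * qLower 1 2 s + E s := by simp only [hE]; nlinarith
          _ ≤ (1 + ε₁) * (h * qLower 1 2 s + E s) := hgrow _ hpos
      · have h2 := integral_kernelE_exp_le_of_two hs2.le hsU
        have hE2 : Real.exp (-s) ≤ 0.14 := le_trans (Real.exp_le_exp.mpr (by linarith)) exp_neg_two_le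
        have hZ3 : qLower 1 2 3 ≤ qLower 1 2 s := zLower_le_zLower hs2.le hs3.le
        have hZ3' := zLower_three_ge
        have hεh : 1 ≤ ε₁ * h := by
          have := mul_le_mul_of_nonneg_left hhε hε₁.le
          rwa [mul_one_div_cancel hε₁.ne'] at this
        have hkey : 0.36 * (0.14:ℝ) ≤ ε₁ * (h * qLower 1 2 s) := by
          calc 0.36 * (0.14:ℝ) ≤ 1 * 0.4034 := by norm_num
            _ ≤ (ε₁ * h) * qLower 1 2 s := mul_le_mul hεh (hZ3'.trans hZ3) (by norm_num) (by nlinarith)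
            _ = ε₁ * (h * qLower 1 2 s) := by ring
        have hEs := (hEpos s).le
        simp only [hE] at hEs ⊢
        calc 2 * h * (∫ t in s..U, sieveKernel (1 / 2) t * (1 - 1 / t) ^ (-(3 / 8 : ℝ)) * qUpper 1 2 (t - 1)) +
              ∫ t in s..U, sieveKernel (1 / 2) t * (1 - 1 / t) ^ (-(3 / 8 : ℝ)) * Real.exp (-(t - 1))
            ≤ 2 * h * ((qLower 1 2 s - qLower 1 2 U) / 2) + 1.36 * Real.exp (-s) :=
              add_le_add (mul_le_mul_of_nonneg_left h1 (by linarith)) h2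
          _ ≤ h * qLower 1 2 s + Real.exp (-s) + 0.36 * 0.14 := by nlinarith
          _ ≤ (1 + ε₁) * (h * qLower 1 2 s + Real.exp (-s)) := by
              have hε0 : 0 ≤ ε₁ * Real.exp (-s) := mul_nonneg hε₁.le hEs
              nlinarith [hkey, hε0]
  · -- (H2): `∫_s^U k_e H⁻(t-1) ≤ (1+ε₁) H⁺(s)` for `2 ≤ s`
    have key3 : ∀ a b : ℝ, 3 ≤ a → a ≤ b →
        ∫ t in a..b, sieveKernel (1 / 2) t * (1 - 1 / t) ^ (-(3 / 8 : ℝ)) * Hm (t - 1) ≤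
          h * ((qUpper 1 2 a - qUpper 1 2 b) / 2) + Real.exp (-a) := by
      intro a b ha hab
      have ha1 : (1:ℝ) < a := lt_of_lt_of_le (by norm_num) ha
      have i1 := mul_le_mul_of_nonneg_left (integral_kernelE_zLower_le ha hab) hh0.le
      have i2 := integral_kernelE_exp_le_of_three ha hab
      have hs2 := hsplit h (qLower 1 2) continuous_zLower ha1 hab
      have hcongr : ∫ t in a..b, sieveKernel (1 / 2) t * (1 - 1 / t) ^ (-(3 / 8 : ℝ)) * Hm (t - 1) =
          ∫ t in a..b, sieveKernel (1 / 2) t * (1 - 1 / t) ^ (-(3 / 8 : ℝ)) * (h * qLower 1 2 (t - 1) + E (t - 1)) := by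
        refine intervalIntegral.integral_congr fun t ht => ?_
        rw [uIcc_of_le hab] at ht
        have ht2 : 2 ≤ t - 1 := by linarith [ht.1]
        have e := hHm_ge (t - 1) ht2
        rw [e]
      rw [hcongr, hs2]
      exact add_le_add i1 i2
    intro s U hs hsU
    have hHps := (hHppos s).le
    rcases le_or_gt 3 s with hs3 | hs3
    · have h1 := key3 s U hs3 hsU
      have hZU := (hZp U).le
      have hZs := (hZp s).le
      set I := ∫ t in s..U, sieveKernel (1 / 2) t * (1 - 1 / t) ^ (-(3 / 8 : ℝ)) * Hm (t - 1) with hIdef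
      clear_value I
      clear key3 hsplit
      have hHp_s : Hp s = 2 * h * qUpper 1 2 s + Real.exp (-s) := by simp only [hHp, hE]
      have h2 : I ≤ Hp s := by
        rw [hHp_s]
        have : h * ((qUpper 1 2 s - qUpper 1 2 U) / 2) ≤ h * (2 * qUpper 1 2 s) :=
          mul_le_mul_of_nonneg_left (by linarith) hh0.le
        linarith
      exact h2.trans (hgrow _ hHps)
    · -- `2 ≤ s < 3`: the numerical case
      set f := fun t : ℝ => sieveKernel (1 / 2) t * (1 - 1 / t) ^ (-(3 / 8 : ℝ)) * Hm (t - 1) with hf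
      set U' := max U 3 with hU'
      have hint : ∀ a b : ℝ, 1 < a → a ≤ b → IntervalIntegrable f volume a b := fun a b ha hab =>
        intervalIntegrable_kernelE_mul (f := fun t => Hm (t - 1)) ha hab
          (hHmc.comp (continuous_id.sub continuous_const)).continuousOn
      have hf0 : ∀ t, 1 < t → 0 ≤ f t := fun t ht => mul_nonneg (kernelE_nonneg ht) (hHmpos _).le
      have h1 : ∫ t in s..U, f t ≤ ∫ t in (2:ℝ)..U', f t :=
        intervalIntegral.integral_mono_interval hs hsU (le_max_left _ _)
          ((ae_restrict_mem measurableSet_Ioc).mono fun t ht => hf0 t (by linarith [ht.1]))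
          (hint 2 U' one_lt_two (le_trans (by norm_num) (le_max_right _ _)))
      have h2 : ∫ t in (2:ℝ)..U', f t = (∫ t in (2:ℝ)..3, f t) + ∫ t in (3:ℝ)..U', f t :=
        (intervalIntegral.integral_add_adjacent_intervals (hint 2 3 one_lt_two (by norm_num))
          (hint 3 U' (by norm_num) (le_max_right _ _))).symm
      have hJ : ∫ t in (2:ℝ)..3, f t ≤ 0.5913 * h + 2.0132 := by
        have hW' : ∀ v : ℝ, 1 ≤ v → v ≤ 2 → Hm v ≤ h * max 1 (4.712 - 4 * (v - 1) ^ ((1:ℝ) / 8)) + 5 :=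
          fun v hv1 hv2 => by rw [hHm_le v hv2]; exact hWprof v hv1 hv2
        exact integral_two_three_le hh0.le hHmc hW'
      have h3 : ∫ t in (3:ℝ)..U', f t ≤ h * ((qUpper 1 2 3 - qUpper 1 2 U') / 2) + Real.exp (-3) :=
        key3 3 U' le_rfl (le_max_right _ _)
      rw [zUpper_eq le_rfl] at h3
      have hZU' := (hZp U').le
      have he3 := exp_neg_three_le
      have hHps' : h ≤ Hp s := by
        simp only [hHp]; rw [zUpper_eq hs3.le]; linarith [hEpos s]
      have h12 : ∫ t in s..U, f t ≤ (∫ t in (2:ℝ)..3, f t) + ∫ t in (3:ℝ)..U', f t := by rw [← h2]; exact h1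
      clear h1 h2 hint key3 hsplit
      set I₀ := ∫ t in s..U, f t with hI₀
      set I₁ := ∫ t in (2:ℝ)..3, f t with hI₁
      set I₂ := ∫ t in (3:ℝ)..U', f t with hI₂
      clear_value I₀ I₁ I₂
      have h3' : I₂ ≤ h / 4 + 0.06 := by
        have : h * ((1 / 2 - qUpper 1 2 U') / 2) ≤ h * (1 / 4) :=
          mul_le_mul_of_nonneg_left (by linarith) hh0.le
        linarith
      have h4 : I₀ ≤ h := by linarith
      exact h4.trans (hHps'.trans (hgrow _ hHps))
  · -- ratio `H⁺(s-1) ≤ R H⁻(s)`, `s ≥ 1`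
    intro s hs
    have hHm0 := hHmpos s
    rcases le_or_gt s₁ s with hcase | hcase
    · have hs32 : 3 ≤ s := le_trans (le_max_right _ _) hcase
      have hu : u₁ ≤ s - 1 := by
        have : max u₁ u₂ + 1 ≤ s₁ := le_max_left _ _
        have : u₁ ≤ max u₁ u₂ := le_max_left _ _
        linarith
      have hq : qUpper 1 2 (s - 1) ≤ Real.exp (-s) := by
        refine (hu₁ (s - 1) hu).trans (Real.exp_le_exp.mpr ?_)
        linarith
      calc Hp (s - 1) = 2 * h * qUpper 1 2 (s - 1) + Real.exp 1 * Real.exp (-s) := by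
            simp only [hHp, hE]; rw [← Real.exp_add]; ring_nf
        _ ≤ 2 * h * Real.exp (-s) + Real.exp 1 * Real.exp (-s) := by gcongr
        _ = (2 * h + Real.exp 1) * Real.exp (-s) := by ring
        _ ≤ (2 * h + Real.exp 1) * Hm s := mul_le_mul_of_nonneg_left (hHm_ge_E s) (by positivity)
        _ ≤ R * Hm s := mul_le_mul_of_nonneg_right (le_max_left _ _) hHm0.le
    · have h1 : Hp (s - 1) ≤ Hp 0 := hHp_anti (by linarith)
      have h2 : Hm s₁ ≤ Hm s := hHm_anti hcase.le
      have hHm1 := hHmpos s₁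
      calc Hp (s - 1) ≤ Hp 0 := h1
        _ = (Hp 0 / Hm s₁) * Hm s₁ := by field_simp
        _ ≤ (Hp 0 / Hm s₁) * Hm s := mul_le_mul_of_nonneg_left h2 (div_nonneg (hHppos _).le hHm1.le)
        _ ≤ R * Hm s := mul_le_mul_of_nonneg_right ((le_max_left _ _).trans (le_max_right _ _)) hHm0.le
  · -- ratio `H⁻(s-1) ≤ R H⁺(s)`, `s ≥ 2`
    intro s hs
    have hHp0 := hHppos s
    rcases le_or_gt s₁ s with hcase | hcase
    · have hs32 : 3 ≤ s := le_trans (le_max_right _ _) hcase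
      have hu : u₂ ≤ s - 1 := by
        have : max u₁ u₂ + 1 ≤ s₁ := le_max_left _ _
        have : u₂ ≤ max u₁ u₂ := le_max_right _ _
        linarith
      have hq : qLower 1 2 (s - 1) ≤ Real.exp (-s) := by
        refine (hu₂ (s - 1) hu).trans (Real.exp_le_exp.mpr ?_)
        linarith
      rw [hHm_ge (s - 1) (by linarith)]
      calc A (s - 1) = h * qLower 1 2 (s - 1) + Real.exp 1 * Real.exp (-s) := by
            simp only [hA, hE]; rw [← Real.exp_add]; ring_nf
        _ ≤ h * Real.exp (-s) + Real.exp 1 * Real.exp (-s) := by gcongr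
        _ ≤ (2 * h + Real.exp 1) * Real.exp (-s) := by nlinarith [Real.exp_pos (-s)]
        _ ≤ (2 * h + Real.exp 1) * Hp s := mul_le_mul_of_nonneg_left (hHp_ge_E s) (by positivity)
        _ ≤ R * Hp s := mul_le_mul_of_nonneg_right (le_max_left _ _) hHp0.le
    · have h1 : Hm (s - 1) ≤ Hm 1 := hHm_anti (by linarith)
      have h2 : Hp s₁ ≤ Hp s := hHp_anti hcase.le
      have hHp1 := hHppos s₁
      calc Hm (s - 1) ≤ Hm 1 := h1
        _ = (Hm 1 / Hp s₁) * Hp s₁ := by field_simp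
        _ ≤ (Hm 1 / Hp s₁) * Hp s := mul_le_mul_of_nonneg_left h2 (div_nonneg (hHmpos _).le hHp1.le)
        _ ≤ R * Hp s := mul_le_mul_of_nonneg_right ((le_max_right _ _).trans (le_max_right _ _)) hHp0.le
  · -- Lemma 17 at `κ = 1/2`
    intro N u
    constructor
    · intro hu
      exact ((hbd N).1 u hu).trans (mul_le_mul_of_nonneg_left (hHm_ge_Z u hu |>.trans' (by nlinarith [hZm u])) hc.le)
    · intro hu
      exact ((hbd N).2 u hu).trans (mul_le_mul_of_nonneg_left (hHp_ge_Z u) hc.le)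

end BetaSieve

end Literature.NumberTheory.Sieve
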